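import Summits.KontsevichZagierPeriods.KontsevichZagierPeriods.Theorems.LogKernelConjecture.Negative.ClauseCensus

/-!
# `LogKernelConjecture` (stmt-KontsevichZagierPeriods-2837) — negative knowledge, part 5: endpoint continuity

Deleting `hcont` (continuity of `t ↦ Vᵢ(x,t)` on the CLOSED fibre `[a x, b x]`) from the shared
logarithmic rule of the cruxes 2836/2837 admits UNSOUND instances: over the point, band `[0,1]`,
`h = 1`, `V(t) = 1 + t` for `t < 1` but `V(1) := 1` (a jump at the upper endpoint, still
`ℚ`-semialgebraic, positive, differentiable on the open fibre with `h V'/V = 1/(1+t)` integrable):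
the band side is `[[0,1], 1/(1+t)]` (value `log 2 > 0`), the base side `[pt, 0]`.  So `ker eval` is
NOT closed under the mutated rule (`not_closedUnderLogNLWithoutCont_ker`) and **`LogPrimitiveNL`
with `hcont` deleted is FALSE** (`logPrimitiveNL_false_without_hcont`): any proof of 2836 must use
endpoint continuity.  The analogously mutated 2837 is a weaker statement and is not decided here.
[cite: KontsevichZagierPeriods2001, §1.2 rule (3)]
-/

noncomputable section

open MeasureTheory Set
open Literature.NumberTheory.Transcendental

namespace Summit.KontsevichZagierPeriods.LiouvilleUnfolding.LogKernelConjectureNegative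

open Summit.KontsevichZagierPeriods.KontsevichZagierPeriods.Theses.LiouvilleUnfolding
  (LogKernelConjecture LogPrimitiveNL)

/-- Lower edge `a = 0` over the point. [folklore] -/
def a₀ : (Fin 0 → ℝ) → ℝ := fun _ => 0

/-- Upper edge `b = 1` over the point. [folklore] -/
def b₀ : (Fin 0 → ℝ) → ℝ := fun _ => 1

/-- The band `[0,1] ⊆ ℝ¹` over the point, in the syntactic shape of the rule. [folklore] -/
def unitBand : Set (Fin 1 → ℝ) :=
  {z | (Fin.init z : Fin 0 → ℝ) ∈ (Set.univ : Set (Fin 0 → ℝ)) ∧ a₀ (Fin.init z) ≤ z (Fin.last 0) ∧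
    z (Fin.last 0) ≤ b₀ (Fin.init z)}

/-- `unitBand = [0, 1]`. [folklore] -/
theorem unitBand_eq_Icc : unitBand = Set.Icc (0 : Fin 1 → ℝ) 1 := by
  ext z
  simp only [unitBand, a₀, b₀, Set.mem_univ, true_and, Set.mem_setOf_eq, Set.mem_Icc, Pi.le_def,
    Fin.forall_fin_one, Pi.zero_apply, Pi.one_apply]
  rfl

/-- `a₀` is `ℚ`-semialgebraic. [folklore] -/
lemma isSemialgebraicFunOn_a₀ : IsSemialgebraicFunOn ℚ (Set.univ : Set (Fin 0 → ℝ)) a₀ := by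
  unfold a₀
  simpa using isSemialgebraicFunOn_natCast
    (Literature.ModelTheory.ExponentialFields.isSemialgebraic_univ (k := ℚ) (R := ℝ) (ι := Fin 0)) 0

/-- `b₀` is `ℚ`-semialgebraic. [folklore] -/
lemma isSemialgebraicFunOn_b₀ : IsSemialgebraicFunOn ℚ (Set.univ : Set (Fin 0 → ℝ)) b₀ := by
  unfold b₀
  simpa using isSemialgebraicFunOn_natCast
    (Literature.ModelTheory.ExponentialFields.isSemialgebraic_univ (k := ℚ) (R := ℝ) (ι := Fin 0)) 1

/-- `unitBand` is `ℚ`-semialgebraic. [folklore] -/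
theorem isSemialgebraic_unitBand :
    Literature.ModelTheory.ExponentialFields.IsSemialgebraic ℚ unitBand :=
  KZlog.isSemialgebraic_band isSemialgebraicFunOn_a₀ isSemialgebraicFunOn_b₀

/-- **`[[0,1], 1/(1+t)]`**, a KZ-literal representation of `log 2`. [folklore] -/
def halfLogRep : KZ.IntegralRep 1 :=
  KZ.IntegralRep.ofRational unitBand 1 (1 + MvPolynomial.X (Fin.last 0)) isSemialgebraic_unitBand
    (fun z hz => by
      have h := hz.2.1
      simp only [a₀] at h
      simp only [map_add, map_one, MvPolynomial.aeval_X]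
      linarith)
    (by
      rw [unitBand_eq_Icc]
      refine ContinuousOn.integrableOn_compact isCompact_Icc ?_
      simp only [map_add, map_one, MvPolynomial.aeval_X]
      refine continuousOn_const.div (by fun_prop) fun z hz => ?_
      have h := hz.1 (Fin.last 0)
      simp only [Pi.zero_apply] at h
      linarith)

/-- The integrand of `halfLogRep` is `1/(1+t)`. [folklore] -/
theorem integrand_halfLogRep : halfLogRep.integrand = fun z => 1 / (1 + z (Fin.last 0)) := by
  funext z
  simp [halfLogRep]

/-- The domain of `halfLogRep` is the unit band. [folklore] -/
theorem domain_halfLogRep : halfLogRep.domain = unitBand := rfl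

/-- **`value [[0,1], 1/(1+t)] > 0`** (it is `log 2`; positivity suffices here). [folklore] -/
theorem value_halfLogRep_pos : 0 < halfLogRep.value := by
  rw [KZ.IntegralRep.value, domain_halfLogRep, integrand_halfLogRep, unitBand_eq_Icc]
  have hpos : ∀ z ∈ Set.Icc (0 : Fin 1 → ℝ) 1, 0 < 1 / (1 + z (Fin.last 0)) := by
    intro z hz
    have h := hz.1 (Fin.last 0)
    simp only [Pi.zero_apply] at h
    positivity
  have hint : IntegrableOn (fun z : Fin 1 → ℝ => 1 / (1 + z (Fin.last 0))) (Set.Icc 0 1) := by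
    have := halfLogRep.integrableOn
    rwa [domain_halfLogRep, integrand_halfLogRep, unitBand_eq_Icc] at this
  rw [setIntegral_pos_iff_support_of_nonneg_ae ?_ hint]
  · have hsub : Set.Icc (0 : Fin 1 → ℝ) 1 ⊆
        Function.support (fun z : Fin 1 → ℝ => 1 / (1 + z (Fin.last 0))) ∩ Set.Icc 0 1 :=
      fun z hz => ⟨Function.mem_support.2 (hpos z hz).ne', hz⟩
    refine lt_of_lt_of_le ?_ (measure_mono hsub)
    rw [Real.volume_Icc_pi]
    simp
  · filter_upwards [ae_restrict_mem measurableSet_Icc] with z hz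
    exact (hpos z hz).le

/-- The discontinuous fibre function: `V(t) = 1 + t` for `t ≠ 1`, `V(1) = 1`. [folklore] -/
def Vjump (z : Fin 1 → ℝ) : ℝ := if z (Fin.last 0) = 1 then 1 else 1 + z (Fin.last 0)

/-- `Vjump` is `ℚ`-semialgebraic on the unit band (glue `1` on `{t = 1}` with `1 + t` on
`{t ≠ 1}`). [folklore] -/
theorem isSemialgebraicFunOn_Vjump : IsSemialgebraicFunOn ℚ unitBand Vjump := by
  have hs1 : Literature.ModelTheory.ExponentialFields.IsSemialgebraic ℚ
      (unitBand ∩ {z : Fin 1 → ℝ | MvPolynomial.aeval z (MvPolynomial.X (Fin.last 0) - 1 :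
        MvPolynomial (Fin 1) ℚ) = 0}) :=
    isSemialgebraic_unitBand.inter
      (Literature.ModelTheory.ExponentialFields.isSemialgebraic_setOf_eval_eq_zero _)
  have hs2 : Literature.ModelTheory.ExponentialFields.IsSemialgebraic ℚ
      (unitBand ∩ {z : Fin 1 → ℝ | MvPolynomial.aeval z (MvPolynomial.X (Fin.last 0) - 1 :
        MvPolynomial (Fin 1) ℚ) ≠ 0}) :=
    isSemialgebraic_unitBand.inter
      (Literature.ModelTheory.ExponentialFields.isSemialgebraic_setOf_eval_ne_zero _)
  have h1 := isSemialgebraicFunOn_natCast hs1 1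
  have h2 := isSemialgebraicFunOn_aeval hs2 (1 + MvPolynomial.X (Fin.last 0))
  have hunion := IsSemialgebraicFunOn.union h1 h2 (F := Vjump) (fun z hz => by
      have h2 : MvPolynomial.aeval z (MvPolynomial.X (Fin.last 0) - 1 : MvPolynomial (Fin 1) ℚ) = 0 :=
        hz.2
      have h : z (Fin.last 0) = 1 := by
        rwa [map_sub, MvPolynomial.aeval_X, map_one, sub_eq_zero] at h2
      rw [Vjump, if_pos h]
      norm_num) (fun z hz => by
      have h2 : MvPolynomial.aeval z (MvPolynomial.X (Fin.last 0) - 1 : MvPolynomial (Fin 1) ℚ) ≠ 0 :=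
        hz.2
      have h : z (Fin.last 0) ≠ 1 := by
        rwa [Ne, map_sub, MvPolynomial.aeval_X, map_one, sub_eq_zero] at h2
      rw [Vjump, if_neg h]
      simp)
  convert hunion using 1
  ext z
  simp only [Set.mem_inter_iff, Set.mem_setOf_eq, Set.mem_union]
  tauto

/-- The closure hypothesis with the fibrewise-continuity clause `hcont` DELETED. [folklore] -/
def ClosedUnderLogNLWithoutCont (R : AddSubgroup KZ.FormalRep) : Prop :=
  ∀ (n k : ℕ) (r : KZ.IntegralRep (n + 1)) (r' : KZ.IntegralRep n) (a b : (Fin n → ℝ) → ℝ)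
    (h : Fin k → (Fin n → ℝ) → ℝ) (V V' : Fin k → (Fin (n + 1) → ℝ) → ℝ),
    IsSemialgebraicFunOn ℚ r'.domain a → IsSemialgebraicFunOn ℚ r'.domain b →
    (∀ x ∈ r'.domain, a x ≤ b x) →
    r.domain = {z | (Fin.init z : Fin n → ℝ) ∈ r'.domain ∧ a (Fin.init z) ≤ z (Fin.last n) ∧
      z (Fin.last n) ≤ b (Fin.init z)} →
    (∀ i, IsSemialgebraicFunOn ℚ r'.domain (h i)) →
    (∀ i, IsSemialgebraicFunOn ℚ r.domain (V i)) →
    (∀ i, ∀ z ∈ r.domain, 0 < V i z) →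
    (∀ i, ∀ x ∈ r'.domain, ∀ t ∈ Set.Ioo (a x) (b x),
      HasDerivAt (fun s : ℝ => V i (Fin.snoc x s)) (V' i (Fin.snoc x t)) t) →
    (∀ i, IntegrableOn (fun z => h i (Fin.init z) * V' i z / V i z) r.domain) →
    (∀ x ∈ r'.domain, ∀ t ∈ Set.Ioo (a x) (b x),
      r.integrand (Fin.snoc x t) = ∑ i, h i x * V' i (Fin.snoc x t) / V i (Fin.snoc x t)) →
    (∀ x ∈ r'.domain, r'.integrand x =
      ∑ i, h i x * (Real.log (V i (Fin.snoc x (b x))) - Real.log (V i (Fin.snoc x (a x))))) →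
    KZ.of r - KZ.of r' ∈ R

/-- **The mutated rule (no `hcont`) is UNSOUND**: no subgroup of `ker eval` is closed under it —
the jump instance `[[0,1], 1/(1+t)] − [pt, 0]` has positive value. [folklore] -/
theorem not_closedUnderLogNLWithoutCont_of_le_ker {R : AddSubgroup KZ.FormalRep}
    (hR : R ≤ KZ.eval.ker) : ¬ ClosedUnderLogNLWithoutCont R := by
  intro hC
  have hu := Literature.ModelTheory.ExponentialFields.isSemialgebraic_univ (k := ℚ) (R := ℝ)
    (ι := Fin 0)
  have hone : IsSemialgebraicFunOn ℚ (Set.univ : Set (Fin 0 → ℝ)) (fun _ => (1 : ℝ)) := by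
    simpa using isSemialgebraicFunOn_natCast hu 1
  have hVpos : ∀ z ∈ unitBand, 0 < Vjump z := by
    intro z hz
    have h := hz.2.1
    simp only [a₀] at h
    unfold Vjump
    split_ifs <;> linarith
  have hsnoc : ∀ (x : Fin 0 → ℝ) (t : ℝ), Vjump (Fin.snoc x t) = if t = 1 then 1 else 1 + t := by
    intro x t; simp only [Vjump, Fin.snoc_last]
  have key := hC 0 1 halfLogRep (zeroRep Set.univ hu) a₀ b₀ (fun _ _ => 1) (fun _ => Vjump)
    (fun _ z => Vjump z / (1 + z (Fin.last 0))) isSemialgebraicFunOn_a₀ isSemialgebraicFunOn_b₀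
    (fun _ _ => by simp [a₀, b₀]) rfl (fun _ => hone) (fun _ => isSemialgebraicFunOn_Vjump)
    (fun _ z hz => hVpos z hz) ?_ ?_ ?_ ?_
  · -- contradiction: the instance has positive value
    have h0 : KZ.eval (KZ.of halfLogRep - KZ.of (zeroRep Set.univ hu)) = 0 :=
      (AddMonoidHom.mem_ker).1 (hR key)
    have hz : (zeroRep (Set.univ : Set (Fin 0 → ℝ)) hu).value = 0 := by
      simp [KZ.IntegralRep.value, zeroRep]
    rw [map_sub, KZ.eval_of, KZ.eval_of, hz, sub_zero] at h0
    exact value_halfLogRep_pos.ne' h0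
  · -- derivative on the open fibre: `V = 1 + t` near every `t < 1`
    intro _ x _ t ht
    have ht0 : (0 : ℝ) < t := ht.1
    have ht1' : t < 1 := ht.2
    have ht1 : t ≠ 1 := ht1'.ne
    have hV' : Vjump (Fin.snoc x t) / (1 + (Fin.snoc x t : Fin 1 → ℝ) (Fin.last 0)) = 1 := by
      rw [hsnoc, if_neg ht1, Fin.snoc_last]
      have : (1 : ℝ) + t ≠ 0 := by linarith
      field_simp
    rw [hV']
    refine HasDerivAt.congr_of_eventuallyEq ((hasDerivAt_id' t).const_add (1 : ℝ)) ?_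
    filter_upwards [Iio_mem_nhds ht1'] with s hs
    have hs1 : s ≠ 1 := ne_of_lt hs
    rw [hsnoc, if_neg hs1]
  · -- termwise integrability: the term IS `1/(1+t)` on the band
    intro _
    refine (halfLogRep.integrableOn).congr_fun (fun z hz => ?_)
      (KZ.IntegralRep.measurableSet_domain_holds halfLogRep)
    rw [integrand_halfLogRep]
    have hz' : Vjump z ≠ 0 := (hVpos z hz).ne'
    simp only [one_mul]
    field_simp
  · -- the band integrand
    intro x _ t ht
    have ht0 : (0 : ℝ) < t := ht.1
    have ht1' : t < 1 := ht.2
    have ht1 : t ≠ 1 := ht1'.ne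
    have : (1 : ℝ) + t ≠ 0 := by linarith
    rw [integrand_halfLogRep, Finset.sum_const, Finset.card_univ, Fintype.card_fin]
    simp only [Fin.snoc_last, one_mul, one_smul, hsnoc, if_neg ht1]
    field_simp
  · -- the base integrand: `log V(1) − log V(0) = log 1 − log 1 = 0`
    intro x _
    simp [zeroRep, hsnoc, a₀, b₀]

/-- **`ker eval` is not closed under the mutated rule.** [folklore] -/
theorem not_closedUnderLogNLWithoutCont_ker : ¬ ClosedUnderLogNLWithoutCont KZ.eval.ker :=
  not_closedUnderLogNLWithoutCont_of_le_ker le_rfl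

/-- **`LogPrimitiveNL` with `hcont` deleted is FALSE** (`KZ.relations ≤ ker eval`): continuity on
the closed fibre is load-bearing for the sibling crux 2836. [folklore] -/
theorem logPrimitiveNL_false_without_hcont : ¬ ClosedUnderLogNLWithoutCont KZ.relations :=
  not_closedUnderLogNLWithoutCont_of_le_ker relations_le_ker

end Summit.KontsevichZagierPeriods.LiouvilleUnfolding.LogKernelConjectureNegative
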